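import Summits.Schanuel.Schanuel.Theorems.RootDecomp1BAlgLiouvilleColumn01

/-!
# RootDecomp1BAlgLiouvilleColumn — lens 4, generation 44, node 3 (g44c) «THE ALGEBRAIC–LIOUVILLE COLUMN, UNCOUPLED» — OF-RECORD, ×0 (CLAIM L2280 + correction L2286; critic ACK L2287: EX-ANTE PRICE ×0 = VARIANT of record of g44b's kernel, no NODE; OF-RECORD files published L2291, verified by the critic L2293; PORT at census's discretion, critic's recommendation YES «already farm-clean and strictly enlarges the tree's reached set») — continuation (RootDecomp1BAlgLiouvilleColumn02): §H3.4–H3.5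

(lens-4 g44c HOME file K3 = HOME/decomp-schanuel-lens-4/g44c/AlgLiouvilleColumn.lean de6287cc…, 1748 l = g44b TwoRadical.lean b925f14a… l.13–1326 VERBATIM (tree: RootDecomp1BTwoRadical01–05) + §H3 (l.1338–1747, namespace `…RootDecomp1BAlgLiouvilleColumn`). Port by census-1 gen 19 of §H3 ONLY, as `RootDecomp1BAlgLiouvilleColumn01` (H3.1 counting along a selection of indices, H3.2 the two frame engines `engine_in` / `engine_out` — kernel `RootDecomp1BTwoRadical.algebraicIndependent_twoRadical` BY NAME —, H3.3 integer relations `exists_nat_eq_intCombination`, the exchange lemma `linearIndependent_update_of_intRel`) and `RootDecomp1BAlgLiouvilleColumn02` (H3.4 the uncoupled column `polarDeg_snoc_algebraic_ultra_of_LW` / `polarDeg_snoc_algebraic_ultra {β : Fin m → ℝ} (hβ : ∀ j, IsAlgebraic ℚ (β j)) (hli : LinearIndependent ℚ β) (hρ : UltraLiouville ρ) : ((m + 1 + (m + 1) + 1 : ℕ) : Cardinal) ≤ polarDeg (Fin.snoc β ρ)` HYP-FREE via `lwMeasure_holds`, H3.5 cells `five_le_polarDeg_sqrt_two_ultra`,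 `four_le_…`, `five_le_polarDeg_sqrt_two_rhoU`, `three_le_polarDeg_ultra`, `three_le_polarDeg_rhoU`, `four_le_trdeg_polar_sqrt_two_ultra`), importing tree `…RootDecomp1BTwoRadical05`; file names follow the namespace (the critic's «TwoRadical06(–07)» numbering is the same two files).
PORT EDITS: linter option dropped; five generic helpers private (`isAlgebraic_sqrt_two`, `linearIndependent_sqrt_two`, `snoc_sqrt_two_eq`, `snoc_elim0_eq`, `card_le_trdeg_of_algebraicIndependent` — dedup-safety) with per-part private copies; four one-line docstrings added; statements and proofs verbatim. `--supports stmt-Schanuel-24622`; no credit of any kind (×0 of record); rung 0 — nothing here proves Schanuel.)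
-/

noncomputable section

open Complex

namespace Summit.Schanuel.Schanuel.Theorems.RootDecomp1BAlgLiouvilleColumn

open Summit.Schanuel.Schanuel.Theorems.RootDecomp1KHyper (LWMeasure)
open Summit.Schanuel.Schanuel.Theorems.RootDecomp1BFedFlagCore (polarDeg polarField coe_mem_polarField
  exp_coe_mem_polarField exp_coe_mul_I_mem_polarField coe_mul_I_mem_polarField)
open Summit.Schanuel.Schanuel.Theorems.RootDecomp1BDefectFloorCells (natCast_le_trdeg_of_algebraicIndependent
  isAlgebraic_polarExp linearIndependent_polar)
open Summit.Schanuel.Schanuel.Theorems.RootDecomp1BRadicalDescent (DExpMeasure dExpMeasure_exp_of_LW UltraLiouville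
  rhoU ultraLiouville_rhoU)
open Summit.Schanuel.Schanuel.Theorems.RootDecomp1BFactDischarge (lwMeasure_holds)
open Summit.Schanuel.Schanuel.Theorems.RootDecomp1BTwoRadical (algebraicIndependent_twoRadical)

/-! ### H3.4 The uncoupled column, mod `hLW` and hypothesis-free -/

/-- **THE ALGEBRAIC–LIOUVILLE COLUMN, EVERY STOREY: `t(β | ρ) ≥ (m+1) + (m+1) + 1`** for `β` real algebraic
`ℚ`-free and `ρ` ultra-Liouville (either sign), mod `hLW`. -/
theorem polarDeg_snoc_algebraic_ultra_of_LW (hLW : LWMeasure) {m : ℕ} {β : Fin m → ℝ}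
    (hβ : ∀ j, IsAlgebraic ℚ ((β j : ℝ) : ℂ)) (hli : LinearIndependent ℚ β) {ρ : ℝ}
    (hρ : UltraLiouville ρ) :
    ((m + 1 + (m + 1) + 1 : ℕ) : Cardinal) ≤ polarDeg (Fin.snoc β ρ : Fin (m + 1) → ℝ) := by
  -- memberships in the polar field `F` of `(β | ρ)`
  have hρm : (ρ : ℂ) ∈ polarField (Fin.snoc β ρ : Fin (m + 1) → ℝ) := by
    simpa only [Fin.snoc_last] using coe_mem_polarField (Fin.snoc β ρ : Fin (m + 1) → ℝ) (Fin.last m)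
  have heρ : cexp (ρ : ℂ) ∈ polarField (Fin.snoc β ρ : Fin (m + 1) → ℝ) := by
    simpa only [Fin.snoc_last] using exp_coe_mem_polarField (Fin.snoc β ρ : Fin (m + 1) → ℝ) (Fin.last m)
  have heρI : cexp ((ρ : ℂ) * Complex.I) ∈ polarField (Fin.snoc β ρ : Fin (m + 1) → ℝ) := by
    simpa only [Fin.snoc_last] using
      exp_coe_mul_I_mem_polarField (Fin.snoc β ρ : Fin (m + 1) → ℝ) (Fin.last m)
  have hebm : ∀ j, cexp ((β j : ℝ) : ℂ) ∈ polarField (Fin.snoc β ρ : Fin (m + 1) → ℝ) := fun j => by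
    simpa only [Fin.snoc_castSucc] using exp_coe_mem_polarField (Fin.snoc β ρ : Fin (m + 1) → ℝ) j.castSucc
  have hebmI : ∀ j, cexp (((β j : ℝ) : ℂ) * Complex.I) ∈ polarField (Fin.snoc β ρ : Fin (m + 1) → ℝ) :=
    fun j => by
    simpa only [Fin.snoc_castSucc] using
      exp_coe_mul_I_mem_polarField (Fin.snoc β ρ : Fin (m + 1) → ℝ) j.castSucc
  have hρne : ρ ≠ 0 := fun h => hρ.irrational ⟨0, by simp [h]⟩
  have hmm : ((m + 1 + (m + 1) + 1 : ℕ) : Cardinal) = ((m + m + 3 : ℕ) : Cardinal) := by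
    congr 1; omega
  rw [hmm]
  -- sign normalisation: `σ = |ρ| > 0` is ultra-Liouville and `e^{σ}, e^{iσ}, σ ∈ F`
  obtain ⟨σ, hσ, hσ0, heσ, heσI, hσm⟩ : ∃ σ : ℝ, UltraLiouville σ ∧ 0 < σ ∧
      cexp (σ : ℂ) ∈ polarField (Fin.snoc β ρ : Fin (m + 1) → ℝ) ∧
      cexp ((σ : ℂ) * Complex.I) ∈ polarField (Fin.snoc β ρ : Fin (m + 1) → ℝ) ∧
      (σ : ℂ) ∈ polarField (Fin.snoc β ρ : Fin (m + 1) → ℝ) := by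
    rcases lt_or_gt_of_ne hρne with hneg | hpos
    · refine ⟨-ρ, hρ.neg, neg_pos.2 hneg, ?_, ?_, ?_⟩
      · rw [Complex.ofReal_neg, Complex.exp_neg]; exact inv_mem heρ
      · rw [Complex.ofReal_neg, neg_mul, Complex.exp_neg]; exact inv_mem heρI
      · rw [Complex.ofReal_neg]; exact neg_mem hρm
    · exact ⟨ρ, hρ, hpos, heρ, heρI, hρm⟩
  by_cases h1 : LinearIndependent ℚ (Fin.cons (1 : ℝ) β : Fin (m + 1) → ℝ)
  · -- case `1 ∉ span_ℚ β`: base `exp(polar(1 | β))`, the members `e, e^i` outside `F`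
    refine engine_out hLW (γ₀ := 1) (by simpa using isAlgebraic_one) hβ h1 hσ hσ0
      (L := polarField (Fin.snoc β ρ : Fin (m + 1) → ℝ)) ?_ ?_ hσm hebm hebmI
    · simpa only [Complex.ofReal_one, mul_one] using heσ
    · simpa only [Complex.ofReal_one, one_mul] using heσI
  · -- case `1 ∈ span_ℚ β`: integer relation `N = Σ n_j β_j`, exchange `β_{j₁} ↦ N`
    have hspan : (1 : ℝ) ∈ Submodule.span ℚ (Set.range β) := by
      by_contra hns
      exact h1 (linearIndependent_finCons.2 ⟨hli, hns⟩)
    obtain ⟨c, hc⟩ := (Submodule.mem_span_range_iff_exists_fun ℚ).1 hspan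
    simp only [Rat.smul_def] at hc
    obtain ⟨N, n, hN0, hNrel⟩ := exists_nat_eq_intCombination c hc
    obtain ⟨j₁, hj₁⟩ : ∃ j, n j ≠ 0 := by
      by_contra hall
      have hall' : ∀ j, n j = 0 := fun j => by simpa using not_exists.mp hall j
      simp only [hall', Int.cast_zero, zero_mul, Finset.sum_const_zero, Nat.cast_eq_zero] at hNrel
      omega
    have hγalg : ∀ j, IsAlgebraic ℚ ((Function.update β j₁ (N : ℝ) j : ℝ) : ℂ) := by
      intro j
      by_cases hj : j = j₁
      · rw [hj, Function.update_self]
        have : ((N : ℝ) : ℂ) = algebraMap ℚ ℂ (N : ℚ) := by push_cast; rfl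
        rw [this]
        exact isAlgebraic_algebraMap _
      · rw [Function.update_of_ne hj]
        exact hβ j
    have hγli : LinearIndependent ℚ (Function.update β j₁ (N : ℝ)) :=
      linearIndependent_update_of_intRel hli n hNrel hj₁
    -- `e^N`, `e^{iN}` are Laurent monomials in the base exponentials, hence in `F`
    have hNC : ((N : ℝ) : ℂ) = ∑ j, (n j : ℂ) * ((β j : ℝ) : ℂ) := by
      have := congrArg (fun x : ℝ => (x : ℂ)) hNrel
      simpa using this
    have heN : cexp ((N : ℝ) : ℂ) ∈ polarField (Fin.snoc β ρ : Fin (m + 1) → ℝ) := by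
      rw [hNC, Complex.exp_sum]
      exact prod_mem fun j _ => by rw [Complex.exp_int_mul]; exact zpow_mem (hebm j) _
    have heNI : cexp (((N : ℝ) : ℂ) * Complex.I) ∈ polarField (Fin.snoc β ρ : Fin (m + 1) → ℝ) := by
      have : ((N : ℝ) : ℂ) * Complex.I = ∑ j, (n j : ℂ) * (((β j : ℝ) : ℂ) * Complex.I) := by
        rw [hNC, Finset.sum_mul]
        exact Finset.sum_congr rfl fun j _ => by ring
      rw [this, Complex.exp_sum]
      exact prod_mem fun j _ => by rw [Complex.exp_int_mul]; exact zpow_mem (hebmI j) _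
    refine engine_in hLW hγalg hγli j₁ hσ hσ0 (L := polarField (Fin.snoc β ρ : Fin (m + 1) → ℝ)) ?_ ?_ hσm
      (fun j => ?_) (fun j => ?_)
    · rw [Function.update_self]
      have : (σ : ℂ) * ((N : ℝ) : ℂ) = (N : ℂ) * (σ : ℂ) := by push_cast; ring
      rw [this, Complex.exp_nat_mul]
      exact pow_mem heσ N
    · rw [Function.update_self]
      have : (σ : ℂ) * (((N : ℝ) : ℂ) * Complex.I) = (N : ℂ) * ((σ : ℂ) * Complex.I) := by push_cast; ring
      rw [this, Complex.exp_nat_mul]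
      exact pow_mem heσI N
    · by_cases hj : j = j₁
      · rw [hj, Function.update_self]; exact heN
      · rw [Function.update_of_ne hj]; exact hebm j
    · by_cases hj : j = j₁
      · rw [hj, Function.update_self]; exact heNI
      · rw [Function.update_of_ne hj]; exact hebmI j

/-- **THE ALGEBRAIC–LIOUVILLE COLUMN, EVERY STOREY, HYPOTHESIS-FREE**: `t(β | ρ) ≥ (m+1) + (m+1) + 1` for every
`ℚ`-free real algebraic `β` and every ultra-Liouville `ρ` (`LWMeasure` discharged by the tree's `lwMeasure_holds`). -/
theorem polarDeg_snoc_algebraic_ultra {m : ℕ} {β : Fin m → ℝ}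
    (hβ : ∀ j, IsAlgebraic ℚ ((β j : ℝ) : ℂ)) (hli : LinearIndependent ℚ β) {ρ : ℝ}
    (hρ : UltraLiouville ρ) :
    ((m + 1 + (m + 1) + 1 : ℕ) : Cardinal) ≤ polarDeg (Fin.snoc β ρ : Fin (m + 1) → ℝ) :=
  polarDeg_snoc_algebraic_ultra_of_LW lwMeasure_holds hβ hli hρ

/-- The Klein–polar inequality AT the uncoupled column (`(m+1) + (m+1) ≤ t(β | ρ)`), hypothesis-free: the
instance of item 24622 at `r = (β | ρ)`. -/
theorem polarDeg_snoc_algebraic_ultra' {m : ℕ} {β : Fin m → ℝ}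
    (hβ : ∀ j, IsAlgebraic ℚ ((β j : ℝ) : ℂ)) (hli : LinearIndependent ℚ β) {ρ : ℝ}
    (hρ : UltraLiouville ρ) :
    ((m + 1 + (m + 1) : ℕ) : Cardinal) ≤ polarDeg (Fin.snoc β ρ : Fin (m + 1) → ℝ) :=
  (Nat.cast_le.2 (by omega)).trans (polarDeg_snoc_algebraic_ultra hβ hli hρ)

/-! ### H3.5 Cells: `(√2, ρ)`, the singleton `(ρ)`, the named member `ρ_U` -/

/-- `√2` is algebraic over `ℚ`. -/
private theorem isAlgebraic_sqrt_two : IsAlgebraic ℚ ((Real.sqrt 2 : ℝ) : ℂ) := by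
  refine ⟨Polynomial.X ^ 2 - Polynomial.C 2, ?_, ?_⟩
  · intro h
    have := congrArg (Polynomial.eval 0) h
    simp at this
  · have h2 : ((Real.sqrt 2 : ℝ) : ℂ) ^ 2 = 2 := by
      rw [← Complex.ofReal_pow, Real.sq_sqrt (by norm_num : (0 : ℝ) ≤ 2)]; simp
    simp [h2]

/-- `(√2)` as a one-term family is `ℚ`-linearly independent (nonzero). -/
private theorem linearIndependent_sqrt_two : LinearIndependent ℚ ![Real.sqrt 2] := by
  rw [Fintype.linearIndependent_iff]
  intro g hg i
  fin_cases i
  simp only [Fin.sum_univ_one, Matrix.cons_val_fin_one, Rat.smul_def, mul_eq_zero, Rat.cast_eq_zero] at hg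
  exact hg.resolve_right (Real.sqrt_ne_zero'.2 (by norm_num))

/-- `Fin.snoc ![√2] ρ = ![√2, ρ]`. -/
private theorem snoc_sqrt_two_eq (ρ : ℝ) : (Fin.snoc ![Real.sqrt 2] ρ : Fin 2 → ℝ) = ![Real.sqrt 2, ρ] := by
  ext i; fin_cases i <;> rfl

/-- **THE CELL `(√2, ρ)`**: `t(√2, ρ) ≥ 5` for EVERY ultra-Liouville `ρ` — UNCONDITIONAL.  Both coordinates structured
(algebraic-irrational | ultra-Liouville), no coupling; the tree has at `(√2 | Liouville)` only the floor `t ≥ 3`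
(`RootDecomp1BFactDischarge.cell_sqrt_two_liouvilleNumber_ten`). -/
theorem five_le_polarDeg_sqrt_two_ultra {ρ : ℝ} (hρ : UltraLiouville ρ) :
    ((5 : ℕ) : Cardinal) ≤ polarDeg ![Real.sqrt 2, ρ] := by
  have h := polarDeg_snoc_algebraic_ultra (β := ![Real.sqrt 2]) (fun j => by
    fin_cases j; simpa using isAlgebraic_sqrt_two) linearIndependent_sqrt_two hρ
  rwa [snoc_sqrt_two_eq] at h

/-- The Klein–polar inequality (crux 24622's body, `m = 2`) AT `r = (√2, ρ)`, hypothesis-free, one to spare. -/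
theorem four_le_polarDeg_sqrt_two_ultra {ρ : ℝ} (hρ : UltraLiouville ρ) :
    ((2 + 2 : ℕ) : Cardinal) ≤ polarDeg ![Real.sqrt 2, ρ] :=
  (Nat.cast_le.2 (by norm_num)).trans (five_le_polarDeg_sqrt_two_ultra hρ)

/-- The cell at the named member `ρ_U` (tree `RootDecomp1BRadicalDescent.rhoU`): `t(√2, ρ_U) ≥ 5`, unconditional. -/
theorem five_le_polarDeg_sqrt_two_rhoU : ((5 : ℕ) : Cardinal) ≤ polarDeg ![Real.sqrt 2, rhoU] :=
  five_le_polarDeg_sqrt_two_ultra ultraLiouville_rhoU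

/-- `Fin.snoc ![] ρ = ![ρ]` (the singleton column). -/
private theorem snoc_elim0_eq (ρ : ℝ) : (Fin.snoc (Fin.elim0 : Fin 0 → ℝ) ρ : Fin 1 → ℝ) = ![ρ] := by
  ext i; fin_cases i; rfl

/-- **THE SINGLETON `(ρ)`**: `t(ρ) = trdeg ℚ(ρ, iρ, e^ρ, e^{iρ}) ≥ 3` for every ultra-Liouville `ρ` — UNCONDITIONAL
(`m = 0`: base `exp(1, i)` entirely outside the field; X(1) value `2`, surplus one). -/
theorem three_le_polarDeg_ultra {ρ : ℝ} (hρ : UltraLiouville ρ) :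
    ((3 : ℕ) : Cardinal) ≤ polarDeg ![ρ] := by
  have h := polarDeg_snoc_algebraic_ultra (β := (Fin.elim0 : Fin 0 → ℝ)) (fun j => Fin.elim0 j)
    linearIndependent_empty_type hρ
  rwa [snoc_elim0_eq] at h

/-- `t(ρ_U) ≥ 3`, unconditional. -/
theorem three_le_polarDeg_rhoU : ((3 : ℕ) : Cardinal) ≤ polarDeg ![rhoU] :=
  three_le_polarDeg_ultra ultraLiouville_rhoU

/-- The crux text of `KleinPolarSchanuel` (item 24622) AT `r = (√2, ρ)`, `polarDeg` unfolded, hypothesis-free. -/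
theorem four_le_trdeg_polar_sqrt_two_ultra {ρ : ℝ} (hρ : UltraLiouville ρ) :
    ((2 + 2 : ℕ) : Cardinal) ≤ Algebra.trdeg ℚ ↥(IntermediateField.adjoin ℚ
      (Set.range (Fin.append (fun j => ((![Real.sqrt 2, ρ] j : ℝ) : ℂ))
          (fun j => ((![Real.sqrt 2, ρ] j : ℝ) : ℂ) * Complex.I)) ∪
        Set.range (Complex.exp ∘ Fin.append (fun j => ((![Real.sqrt 2, ρ] j : ℝ) : ℂ))
          (fun j => ((![Real.sqrt 2, ρ] j : ℝ) : ℂ) * Complex.I)))) :=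
  four_le_polarDeg_sqrt_two_ultra hρ

end Summit.Schanuel.Schanuel.Theorems.RootDecomp1BAlgLiouvilleColumn

end
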